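import Literature.AlgebraicGeometry.Motives.PullbackOver
import Literature.AlgebraicGeometry.Motives.ComplexPointsOpenDense
import Mathlib.AlgebraicGeometry.Morphisms.Etale
import Mathlib.AlgebraicGeometry.Morphisms.FlatMono
import HarnessLib

/-!
# An étale morphism of `ℂ`-schemes which is bijective on complex points is an isomorphism

For `ℂ`-schemes `Z`, `C` locally of finite type and an étale `ℂ`-morphism `p : Z ⟶ C` which is
**bijective on complex points**, `p` is an isomorphism (`isIso_of_etale_of_bijective_map`). This is the
analytic-to-algebraic step "a sheet of a finite étale cover mapping homeomorphically onto the base is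
(algebraically) isomorphic to the base" in the comparison of topological and algebraic coverings
(SGA1 XII Thm. 5.1, Riemann's existence theorem, in its easy direction; Görtz–Wedhorn I,
Prop. 14.18-style argument). Proof, entirely with Mathlib's morphism classes:

1. `isIso_diagonal_of_injective_map`: `p` is unramified, so its diagonal
   `Δ : Z → Z ×_C Z` is an open immersion (Mathlib `FormallyUnramified.isOpenImmersion_diagonal`);
   a complex point of `Z ×_C Z` is a pair `(P, Q)` with `p P = p Q` (`pullbackOver.pointsEquiv`),
   hence `P = Q` and the point lies on the diagonal; an open containing all complex points is
   everything (`isOpen_eq_univ_of_forall_pt_mem`, Nullstellensatz + Jacobson), so `Δ` is an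
   isomorphism, i.e. `p` is a monomorphism (Mathlib `pullback.isIso_diagonal_iff`);
2. a flat monomorphism locally of finite presentation is an open immersion (Mathlib
   `IsOpenImmersion.of_flat_of_mono`, Stacks 06NC);
3. an open immersion onto on complex points is an isomorphism
   (`isIso_left_of_isOpenImmersion_of_surjective_map`).

Used towards `Literature.AlgebraicGeometry.Motives.isIso_bettiCohomology_map_abelJacobi` (the lifted
component of `C ×_J J'`). Everything is proved; no definitions.

## References

* A. Grothendieck, SGA1, Exp. I Thm. 5.1 ("étale + radiciel + surjectif ⇒ isomorphisme"), Exp. XII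
  Thm. 5.1. [SGA1]
* The Stacks Project, Tag 06NC, Tag 02LC.
-/

noncomputable section

open CategoryTheory CategoryTheory.Limits AlgebraicGeometry

namespace Literature.AlgebraicGeometry.Motives

variable {Z C : SchemeOver ℂ} (p : Z ⟶ C)

/-- **The diagonal of an unramified `p` injective on complex points is an isomorphism**, hence `p` is a
monomorphism: the diagonal is an open immersion whose (open) image contains every complex point of
`Z ×_C Z` — such a point is a pair `(P, Q)` with `p P = p Q`, so `P = Q`. [cite: SGA1, Exp. I Thm. 5.1] -/
theorem isIso_diagonal_of_injective_map [LocallyOfFiniteType Z.hom] [FormallyUnramified p.left]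
    [LocallyOfFiniteType p.left] (hinj : Function.Injective (AlgPoints.map (L := ℂ) p)) :
    IsIso (pullback.diagonal p.left) := by
  haveI : LocallyOfFiniteType (pullbackOver p p).hom := by
    change LocallyOfFiniteType (pullback.fst p.left p.left ≫ Z.hom)
    infer_instance
  rw [isIso_iff_isOpenImmersion_and_surjective]
  refine ⟨inferInstance, ⟨fun y => ?_⟩⟩
  have huniv := isOpen_eq_univ_of_forall_pt_mem (T := pullbackOver p p)
    (pullback.diagonal p.left).isOpenEmbedding.isOpen_range fun R => by
    -- `R = (P, Q)` with `p P = p Q`, so `P = Q` and `R = Δ(P)`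
    have hPQ : AlgPoints.map (pullbackOver.fst p p) R = AlgPoints.map (pullbackOver.snd p p) R :=
      hinj (pullbackOver.pointsEquiv p p ℂ R).2
    have hR : R = AlgPoints.map (pullbackOver.lift (f := p) (g := p) (𝟙 Z) (𝟙 Z) rfl)
        (AlgPoints.map (pullbackOver.fst p p) R) := by
      refine pullbackOver.hom_ext ?_ ?_
      · rw [AlgPoints.map_apply, AlgPoints.map_apply, Category.assoc, pullbackOver.lift_fst,
          Category.comp_id]
      · rw [AlgPoints.map_apply, AlgPoints.map_apply, Category.assoc, pullbackOver.lift_snd,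
          Category.comp_id, ← AlgPoints.map_apply, ← AlgPoints.map_apply, hPQ]
    refine ⟨(AlgPoints.map (pullbackOver.fst p p) R).pt, ?_⟩
    conv_rhs => rw [hR]
    rfl
  have : y ∈ Set.range (pullback.diagonal p.left) := by rw [huniv]; trivial
  exact this

/-- **An étale morphism of `ℂ`-schemes (locally of finite type) which is bijective on complex points
is an isomorphism**: a monomorphism by `isIso_diagonal_of_injective_map`, hence a flat monomorphism of
finite presentation, i.e. an open immersion (Stacks 06NC), which is onto on complex points.
[cite: SGA1, Exp. I Thm. 5.1] -/
theorem isIso_left_of_etale_of_bijective_map [LocallyOfFiniteType Z.hom] [LocallyOfFiniteType C.hom]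
    [Etale p.left] (hbij : Function.Bijective (AlgPoints.map (L := ℂ) p)) : IsIso p.left := by
  haveI : IsIso (pullback.diagonal p.left) := isIso_diagonal_of_injective_map p hbij.1
  haveI : Mono p.left := (CategoryTheory.Limits.pullback.isIso_diagonal_iff p.left).mp inferInstance
  haveI : IsOpenImmersion p.left := IsOpenImmersion.of_flat_of_mono p.left
  exact isIso_left_of_isOpenImmersion_of_surjective_map p hbij.2

/-- The same, as an isomorphism of `ℂ`-schemes (`Over (Spec ℂ)`). [cite: SGA1, Exp. I Thm. 5.1] -/
theorem isIso_of_etale_of_bijective_map [LocallyOfFiniteType Z.hom] [LocallyOfFiniteType C.hom]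
    [Etale p.left] (hbij : Function.Bijective (AlgPoints.map (L := ℂ) p)) : IsIso p :=
  haveI := isIso_left_of_etale_of_bijective_map p hbij
  isIso_of_isIso_left p

end Literature.AlgebraicGeometry.Motives

end
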